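import Literature.AlgebraicGeometry.Resolution.BaseTreeFinite
import Literature.AlgebraicGeometry.Resolution.QuadraticTransformsUFD

/-!
# Gcd bookkeeping in a two-dimensional regular local ring (crux `Valuative.LuAlphaPTorsor`, line `pfaff-line-log-final-forms`)

Helper file for the stub `exists_eq_span_prod_pow_mul_of_forall_prime` (P1c) of the line
`pfaff-line-log-final-forms` (item `stmt-ResolutionOfSingularities-0641`). In Giraud's
induction the log-content ideal `J ≠ 0` of a two-dimensional regular local ring `(R, 𝔪)` is
written `J = (g) · J₀` with `J₀` contained in no proper principal ideal
(`exists_eq_span_singleton_mul_forall_not_le`), hence of finite colength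
(`isFiniteLength_quotient_of_forall_not_le`). Phase 1 of the line arranges that every prime
element `p` with `J ⊆ (p)` generates one of the two boundary curves `(u 0)`, `(u 1)` of a regular
system of parameters `u`. Since `R` is factorial (`uniqueFactorizationMonoid_of_ringKrullDim_eq_two`),
the divisorial part `g` is then a unit times a monomial `u 0 ^ a * u 1 ^ b`
(`exists_associated_pow_mul_pow_of_forall_prime_dvd`, induction on the prime factorisation), so
`J = (u 0 ^ a * u 1 ^ b) · J₀`.
-/

set_option linter.dupNamespace false

noncomputable section

open IsLocalRing Literature.AlgebraicGeometry.Resolution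

namespace Summit.ResolutionOfSingularities.ResolutionOfSingularities.Theorems.PfaffLine

section GcdBookkeeping

/-- In a unique factorisation monoid, a non-zero element all of whose prime divisors are
associated to `a` or to `b` is associated to a monomial `a ^ m * b ^ n` (induction on the
prime factorisation). [folklore] -/
theorem exists_associated_pow_mul_pow_of_forall_prime_dvd {α : Type*} [CommMonoidWithZero α]
    [UniqueFactorizationMonoid α] (a b : α) {g : α} (hg : g ≠ 0)
    (h : ∀ p : α, Prime p → p ∣ g → Associated p a ∨ Associated p b) :
    ∃ m n : ℕ, Associated g (a ^ m * b ^ n) := by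
  induction g using UniqueFactorizationMonoid.induction_on_prime with
  | h₁ => exact absurd rfl hg
  | h₂ x hx =>
    refine ⟨0, 0, ?_⟩
    rw [pow_zero, pow_zero, mul_one]
    exact associated_one_iff_isUnit.mpr hx
  | h₃ c p hc hp ih =>
    obtain ⟨m, n, hmn⟩ := ih hc fun q hq hqc => h q hq (hqc.mul_left p)
    rcases h p hp (dvd_mul_right p c) with hpa | hpb
    · refine ⟨m + 1, n, ?_⟩
      rw [pow_succ', mul_assoc]
      exact hpa.mul_mul hmn
    · refine ⟨m, n + 1, ?_⟩
      rw [pow_succ', mul_left_comm]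
      exact hpb.mul_mul hmn

open IsLocalRing

/-- **Gcd bookkeeping** (P1c): in a two-dimensional regular local ring `(R, 𝔪)` with regular
system of parameters `u`, a non-zero ideal `J` such that every prime element `p` with `J ⊆ (p)`
generates `(u 0)` or `(u 1)` is `(u 0 ^ M 0 * u 1 ^ M 1) · J₀` with `R ⧸ J₀` of finite length:
write `J = (g) · J₀` with `J₀` in no proper principal ideal (hence `𝔪`-primary or the unit
ideal); every prime factor of `g` contains `J`, so is an associate of `u 0` or `u 1`, and `R`
being factorial `g` is a unit times `u 0 ^ a * u 1 ^ b`. [folklore] -/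
theorem exists_eq_span_prod_pow_mul_of_forall_prime : ∀ {R : Type*} [CommRing R] [IsRegularLocalRing R], ringKrullDim R = 2 → ∀ (u : Fin 2 → R), Ideal.span (Set.range u) = maximalIdeal R → ∀ (J : Ideal R), J ≠ ⊥ → (∀ p : R, Prime p → J ≤ Ideal.span {p} → (Ideal.span {p} = Ideal.span {u 0} ∨ Ideal.span {p} = Ideal.span {u 1})) → ∃ (M : Fin 2 → ℕ) (J₀ : Ideal R), J = Ideal.span {Finset.univ.prod fun i => u i ^ M i} * J₀ ∧ IsFiniteLength R (R ⧸ J₀) := by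
  intro R _ _ hdim u _hu J hJ hprime
  haveI := isDomain_of_isRegularLocalRing R
  haveI := uniqueFactorizationMonoid_of_ringKrullDim_eq_two hdim
  obtain ⟨g, J₀, hg0, hJeq, hJ₀⟩ := exists_eq_span_singleton_mul_forall_not_le J hJ
  have hdvd : ∀ p : R, Prime p → p ∣ g → Associated p (u 0) ∨ Associated p (u 1) := by
    intro p hp hpg
    have hle : J ≤ Ideal.span {p} := by
      rw [hJeq]
      exact Ideal.mul_le_right.trans (Ideal.span_singleton_le_span_singleton.mpr hpg)
    rcases hprime p hp hle with h | h
    · exact Or.inl (Ideal.span_singleton_eq_span_singleton.mp h)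
    · exact Or.inr (Ideal.span_singleton_eq_span_singleton.mp h)
  obtain ⟨m, n, hmn⟩ := exists_associated_pow_mul_pow_of_forall_prime_dvd (u 0) (u 1) hg0 hdvd
  refine ⟨![m, n], J₀, ?_, isFiniteLength_quotient_of_forall_not_le hdim hJ₀⟩
  simp only [Fin.prod_univ_two, Matrix.cons_val_zero, Matrix.cons_val_one]
  rw [← Ideal.span_singleton_eq_span_singleton.mpr hmn]
  exact hJeq

end GcdBookkeeping

end Summit.ResolutionOfSingularities.ResolutionOfSingularities.Theorems.PfaffLine
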